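import Literature.RingTheory.LocalCohomology.CechH2Noetherian
import Literature.RingTheory.LocalCohomology.ConnectednessCechLemmas
import Literature.RingTheory.LocalCohomology.SyzygyModule
import HarnessLib

/-!
# Grothendieck's connectedness theorem: the analytic core

Topic `Literature/RingTheory/LocalCohomology`. The heart of the proof of Grothendieck's connectedness
theorem (SGA 2 XIII 2.1, `GrothendieckConnectednessProofs.lean`) in an algebraic form. Let `D` be a
complete Noetherian local domain, module-finite over a local Noetherian domain `S ⊆ D`, and let
`x₁, x₂, x₃ ∈ S` be an `S`-regular sequence of non-units of `D` (in the application `S` is a Cohen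
regular subring and `V(x₁, x₂, x₃)` a closed subset of codimension `≥ 3`). Let `0 ≠ g ∈ D` and let
`𝔞₁, 𝔞₂ ∋ g` be ideals with `V(𝔞₁) ∩ V(𝔞₂) ⊆ V(x)` and `V(g) ⊆ V(𝔞₁) ∪ V(𝔞₂) ∪ V(x)` — a
disconnection of `V(g) ∖ V(x)` into the closed pieces `V(𝔞ᵢ) ∖ V(x)`. Then one of the two pieces is
empty: there cannot be primes `Q₁ ⊇ 𝔞₁`, `Q₂ ⊇ 𝔞₂` off `V(x)` and off the other piece
(`grothendieck_core`).

Proof (module-theoretic substitute for the local Lefschetz theorem `Lef(X, Y)` of SGA 2 X 2.1 /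
XII 3.4, avoiding duality): let `M = Hom_S(D, S)` (`SyzygyModule.lean`), a non-zero torsion-free
`D`-module which is a second syzygy over `S`; along `(x)` it has depth `≥ 2` (`M ≅ Z⁰(x; M)`) and
Noetherian `H²` (`CechH2Noetherian.lean`), so the `g`-power torsion of `H²(x; M)` is killed by a fixed
`g^{N₀}` and the cokernels of `M/g^N M → Γ_N := Z⁰(x; M/g^N M)` are killed by `g^{N₀}`
(`ConnectednessCechLemmas.lean`). The sections `Γ_N` split along the two pieces; for `m ∈ M` the
`𝔞₁`-components of the images of `m`, multiplied by `g^{N₀}`, lift compatibly to `a_N ∈ M`, which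
converge `g`-adically to `a ∈ M`. Localising at `Q₂` (where `𝔞₁` becomes the unit ideal) shows
`a ∈ ⋂ g^N M_{Q₂} = 0`; then localising at `Q₁` shows `g^{N₀} m ∈ ⋂ g^N M_{Q₁} = 0`, so `m = 0`:
`M = 0`, a contradiction.

Everything is proved; no definitions, no named facts.

## References

* [Grothendieck1968SGA2] A. Grothendieck, SGA 2, Exp. XIII §2, Thm. 2.1 and the "principe de la
  démonstration" (arXiv:math/0511279, p. 95); Exp. X 2.1, XII 3.4 (the Lefschetz condition).
* [BrodmannSharp1998] M. Brodmann, R. Sharp, *Local cohomology*, CUP 1998, Ch. 19 (connectivity).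
-/

noncomputable section

open CategoryTheory IsLocalRing RingTheory.Sequence Pointwise

universe u

namespace Literature.RingTheory.LocalCohomology

/-! ## Two small Čech lemmas -/

section Aux

variable {R : Type u} [CommRing R] {s : ℕ} {y : Fin s → R} {M' : Type u} [AddCommGroup M']
  [Module R M']

/-- If `w · (v/1) = 0` in `M'_{y_t}` then `(y_t^k w) v = 0` for some `k`. [folklore] -/
theorem exists_pow_mul_smul_eq_zero_of_smul_mk_eq_zero {n : ℕ} (t : Fin (n + 1) → Fin s) (w : R)
    (v : M') (h : w • (LocalizedModule.mk v 1 : CechLoc y M' t) = 0) :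
    ∃ k : ℕ, (tupleProd y t ^ k * w) • v = 0 := by
  rw [LocalizedModule.smul'_mk, ← LocalizedModule.zero_mk 1, LocalizedModule.mk_eq] at h
  obtain ⟨⟨_, k, rfl⟩, hk⟩ := h
  refine ⟨k, ?_⟩
  simpa only [smul_zero, one_smul, Submonoid.smul_def, smul_smul] using hk

/-- For a constant tuple `t ≡ i` of length one, `y_t = y_i`. [folklore] -/
theorem tupleProd_const_one (i : Fin s) : tupleProd y (fun _ : Fin 1 => i) = y i := by
  simp [tupleProd]

end Aux

/-! ## The core -/

section Core

variable {S D : Type u} [CommRing S] [IsDomain S] [IsNoetherianRing S] [IsLocalRing S]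
  [CommRing D] [IsDomain D] [IsNoetherianRing D] [IsLocalRing D]
  [IsAdicComplete (maximalIdeal D) D] [Algebra S D] [Module.Finite S D]

/-- **Grothendieck's connectedness theorem, analytic core.** Let `D` be a complete Noetherian local
domain, module-finite over a local Noetherian domain `S` with `S → D` injective; let `x₁, x₂, x₃ ∈ S`
be `S`-regular and non-units in `D`; `0 ≠ g ∈ D`; `𝔞₁, 𝔞₂ ∋ g` ideals with
`(𝔞₁ 𝔞₂ (x))^e ⊆ (g)` (i.e. `V(g) ⊆ V(𝔞₁) ∪ V(𝔞₂) ∪ V(x)`) and `xᵢ^L ∈ 𝔞₁ + 𝔞₂` (i.e.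
`V(𝔞₁) ∩ V(𝔞₂) ⊆ V(x)`). Then there are no primes `Q₁ ⊇ 𝔞₁`, `Q₂ ⊇ 𝔞₂` with
`Q₁ ⊉ 𝔞₂, (x)` and `Q₂ ⊉ 𝔞₁, (x)`: the punctured hypersurface `V(g) ∖ V(x₁, x₂, x₃)` is not
disconnected by the pieces `V(𝔞₁)`, `V(𝔞₂)`. This is the case `k = 1` / the inductive kernel of
SGA 2 XIII 2.1, proved here through the second-syzygy module `Hom_S(D, S)` instead of the local
Lefschetz theorems. [cite: Grothendieck1968SGA2, Exp. XIII Thm. 2.1] -/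
theorem grothendieck_core (hinj : Function.Injective (algebraMap S D)) (x : Fin 3 → S)
    (hx : IsWeaklyRegular S [x 0, x 1, x 2]) (hxm : ∀ i, algebraMap S D (x i) ∈ maximalIdeal D)
    {g : D} (hg0 : g ≠ 0) {𝔞₁ 𝔞₂ : Ideal D} (hg₁ : g ∈ 𝔞₁) (hg₂ : g ∈ 𝔞₂)
    (hcov : ∃ e : ℕ, (𝔞₁ * 𝔞₂ * Ideal.span (Set.range (yB D x))) ^ e ≤ Ideal.span {g})
    (hsep : ∀ i, ∃ L : ℕ, yB D x i ^ L ∈ 𝔞₁ ⊔ 𝔞₂)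
    {Q₁ Q₂ : Ideal D} [Q₁.IsPrime] [Q₂.IsPrime]
    (h₁ : 𝔞₁ ≤ Q₁) (h₁' : ¬ 𝔞₂ ≤ Q₁) (h₁y : ∃ i, yB D x i ∉ Q₁)
    (h₂ : 𝔞₂ ≤ Q₂) (h₂' : ¬ 𝔞₁ ≤ Q₂) (h₂y : ∃ i, yB D x i ∉ Q₂) : False := by
  classical
  /- 1. The module `M = Hom_S(D, S)`. -/
  obtain ⟨M, _, _, _, _, hfinS, hnt, htf, a, b, ι, π, hι, hex⟩ := exists_dual_syzygy_module S D hinj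
  haveI : Module.Finite D M := Module.Finite.of_restrictScalars_finite S D M
  have hgreg : IsSMulRegular M g :=
    isSMulRegular_iff_right_eq_zero_of_smul.mpr fun m hm => (htf g m hm).resolve_left hg0
  have hgm : g ∈ maximalIdeal D :=
    IsLocalRing.le_maximalIdeal (Ideal.IsPrime.ne_top inferInstance) (h₁ hg₁)
  /- 2. Regular sequences. -/
  have hxS : ∀ i, x i ∈ maximalIdeal S := fun i hu =>
    (IsLocalRing.mem_maximalIdeal _).mp (hxm i) (hu.map (algebraMap S D))
  have hx2 : IsWeaklyRegular S [x 0, x 1] := by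
    rw [isWeaklyRegular_cons_iff, isWeaklyRegular_cons_iff] at hx ⊢
    exact ⟨hx.1, hx.2.1, IsWeaklyRegular.nil _ _⟩
  have hmem3 : ∀ r ∈ [x 0, x 1, x 2], r ∈ maximalIdeal S := by
    intro r hr
    simp only [List.mem_cons, List.not_mem_nil, or_false] at hr
    rcases hr with rfl | rfl | rfl <;> exact hxS _
  have hmem2 : ∀ r ∈ [x 0, x 1], r ∈ maximalIdeal S := fun r hr =>
    hmem3 r (by simp only [List.mem_cons, List.not_mem_nil, or_false] at hr ⊢; tauto)
  have hmemD : ∀ r ∈ [yB D x 0, yB D x 1], r ∈ maximalIdeal D := by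
    intro r hr
    simp only [List.mem_cons, List.not_mem_nil, or_false] at hr
    rcases hr with rfl | rfl <;> exact hxm _
  have hregM : IsRegular M [yB D x 0, yB D x 1] :=
    IsRegular.of_isWeaklyRegular_of_mem_maximalIdeal (L := M) hmemD
      (isWeaklyRegular_pair_of_exact ι π hι hex hx2)
  have hregF : IsRegular (Fin (a + 1) → S) [x 0, x 1, x 2] :=
    IsRegular.of_isWeaklyRegular_of_mem_maximalIdeal (L := Fin (a + 1) → S) hmem3
      (isWeaklyRegular_pi hx (a + 1))
  have hregP : IsRegular (Fin (b + 1) → S) [x 0, x 1] :=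
    IsRegular.of_isWeaklyRegular_of_mem_maximalIdeal (L := Fin (b + 1) → S) hmem2
      (isWeaklyRegular_pi hx2 (b + 1))
  /- 3. Čech exactness: `M ≅ Z⁰(x; M)` over `D`; `H²(x; S^{a+1}) = 0` and `S^{b+1} ≅ Z⁰` over `S`. -/
  have hradD : ∀ r ∈ [yB D x 0, yB D x 1], r ∈ (Ideal.span (Set.range (yB D x))).radical := by
    intro r hr
    simp only [List.mem_cons, List.not_mem_nil, or_false] at hr
    rcases hr with rfl | rfl <;> exact Ideal.le_radical (Ideal.subset_span ⟨_, rfl⟩)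
  have hradS3 : ∀ r ∈ [x 0, x 1, x 2], r ∈ (Ideal.span (Set.range x)).radical := by
    intro r hr
    simp only [List.mem_cons, List.not_mem_nil, or_false] at hr
    rcases hr with rfl | rfl | rfl <;> exact Ideal.le_radical (Ideal.subset_span ⟨_, rfl⟩)
  have hradS2 : ∀ r ∈ [x 0, x 1], r ∈ (Ideal.span (Set.range x)).radical := fun r hr =>
    hradS3 r (by simp only [List.mem_cons, List.not_mem_nil, or_false] at hr ⊢; tauto)
  obtain ⟨hM0, hM1, -⟩ := cech_exact_of_isRegular (y := yB D x) [yB D x 0, yB D x 1] M hregM hradD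
  replace hM0 := hM0 (by simp)
  replace hM1 := hM1 (by simp)
  obtain ⟨-, -, hF2⟩ := cech_exact_of_isRegular (y := x) [x 0, x 1, x 2] (Fin (a + 1) → S) hregF hradS3
  replace hF2 := hF2 0 (by simp)
  obtain ⟨hP0, hP1, -⟩ := cech_exact_of_isRegular (y := x) [x 0, x 1] (Fin (b + 1) → S) hregP hradS2
  replace hP0 := hP0 (by simp)
  replace hP1 := hP1 (by simp)
  /- 4. `H²(x; M)` is Noetherian over `S`; uniform bound `N₀` on its `g`-power torsion. -/
  let π' : (Fin (a + 1) → S) →ₗ[S] LinearMap.range π := π.rangeRestrict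
  have hπ' : Function.Surjective π' := LinearMap.surjective_rangeRestrict π
  have hex' : Function.Exact ι π' := fun w => by
    rw [← hex w]
    constructor
    · intro h
      exact congrArg Subtype.val h
    · intro h
      exact Subtype.ext h
  haveI : IsNoetherian S (LinearMap.ker (dC (y := x) (M := LinearMap.range π) 0)) := by
    haveI := finite_ker_dC_zero_of_injective (y := x) (LinearMap.range π).subtype
      Subtype.val_injective hP0 hP1
    infer_instance
  haveI : IsNoetherian S (H2 (y := x) (M := M)) := isNoetherian_H2_of_exact ι π' hι hπ' hex' hF2
  obtain ⟨N₀, hN₀⟩ := exists_uniform_pow_smul_mem_range D x M g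
  /- 5. Exponents: `(𝔞₁ 𝔞₂ (x))^(eN)` kills `M/g^N M`; powers of the `xᵢ` lie in `𝔞₁^n + 𝔞₂^n`. -/
  obtain ⟨e, he⟩ := hcov
  have hkill : ∀ N : ℕ, ∀ a' ∈ 𝔞₁ ^ (e * N), ∀ b' ∈ 𝔞₂ ^ (e * N), ∀ (i : Fin 3)
      (v : QuotSMulTop (g ^ N) M), (a' * b' * yB D x i ^ (e * N)) • v = 0 := by
    intro N a' ha' b' hb' i v
    have hyi : yB D x i ∈ Ideal.span (Set.range (yB D x)) := Ideal.subset_span (Set.mem_range_self i)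
    have hmem : a' * b' * yB D x i ^ (e * N) ∈ Ideal.span {g ^ N} := by
      have h1 : a' * b' * yB D x i ^ (e * N) ∈ (𝔞₁ * 𝔞₂ * Ideal.span (Set.range (yB D x))) ^ (e * N) := by
        rw [mul_pow, mul_pow]
        exact Ideal.mul_mem_mul (Ideal.mul_mem_mul ha' hb') (Ideal.pow_mem_pow hyi _)
      have h2 : (𝔞₁ * 𝔞₂ * Ideal.span (Set.range (yB D x))) ^ (e * N) ≤ Ideal.span {g ^ N} := by
        rw [pow_mul, ← Ideal.span_singleton_pow]
        exact Ideal.pow_right_mono he N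
      exact h2 h1
    obtain ⟨r, hr⟩ := Ideal.mem_span_singleton'.mp hmem
    rw [← hr, mul_smul, smul_quot (g ^ N) v, smul_zero]
  have hsepN : ∀ n : ℕ, ∀ i, ∃ L : ℕ, yB D x i ^ L ∈ 𝔞₁ ^ n ⊔ 𝔞₂ ^ n := by
    intro n i
    obtain ⟨L, hL⟩ := hsep i
    refine ⟨L * (n + n), ?_⟩
    rw [pow_mul]
    exact Ideal.sup_pow_add_le_pow_sup_pow (Ideal.pow_mem_pow hL _)
  /- 6. A non-zero `m ∈ M`; the split sections and their compatible lifts `a_N`. -/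
  obtain ⟨m, hm0⟩ := exists_ne (0 : M)
  have hdec : ∀ N : ℕ, ∃ c₁ c₂ : CechObj (yB D x) (QuotSMulTop (g ^ N) M) 0,
      cechAug (yB D x) (QuotSMulTop (g ^ N) M) (toQuot (g ^ N) m) = c₁ + c₂ ∧ dC 0 c₁ = 0 ∧
        dC 0 c₂ = 0 ∧ (∀ a' ∈ 𝔞₁ ^ (e * N), a' • c₁ = 0) ∧ (∀ b' ∈ 𝔞₂ ^ (e * N), b' • c₂ = 0) :=
    fun N => exists_split_cocycle (hsepN (e * N)) (hkill N) _ (dC_cechAug _)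
  choose c₁ c₂ hc₁₂ hdc₁ hdc₂ hc₁ hc₂ using hdec
  have hlift : ∀ N : ℕ, ∃ aN : M,
      cechAug (yB D x) (QuotSMulTop (g ^ N) M) (toQuot (g ^ N) aN) = g ^ N₀ • c₁ N := fun N =>
    exists_cechAug_toQuot_eq_pow_smul (y := yB D x) hgreg N N₀ hM1 hN₀ (c₁ N) (hdc₁ N)
  choose aseq haseq using hlift
  /- 7. Compatibility `a_{N+1} ≡ a_N mod g^N M` (uniqueness of the splitting, naturality). -/
  have hle : ∀ N : ℕ, (g ^ (N + 1) • ⊤ : Submodule D M) ≤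
      ((g ^ N • ⊤ : Submodule D M)).comap (LinearMap.id : M →ₗ[D] M) := by
    intro N v hv
    obtain ⟨w, -, rfl⟩ := (Submodule.mem_smul_pointwise_iff_exists _ _ _).mp hv
    rw [Submodule.mem_comap, LinearMap.id_apply, pow_succ, mul_smul]
    exact Submodule.smul_mem_pointwise_smul _ _ _ Submodule.mem_top
  let ρ : ∀ N : ℕ, QuotSMulTop (g ^ (N + 1)) M →ₗ[D] QuotSMulTop (g ^ N) M := fun N =>
    Submodule.mapQ _ _ LinearMap.id (hle N)
  have hρ : ∀ (N : ℕ) (v : M), ρ N (toQuot (g ^ (N + 1)) v) = toQuot (g ^ N) v := fun N v => rfl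
  have hρaug : ∀ (N : ℕ) (v : M), cechObjMap (yB D x) (ρ N) 0
      (cechAug (yB D x) (QuotSMulTop (g ^ (N + 1)) M) (toQuot (g ^ (N + 1)) v)) =
        cechAug (yB D x) (QuotSMulTop (g ^ N) M) (toQuot (g ^ N) v) := by
    intro N v
    rw [← cechAug_map, hρ]
  have hc₁ρ : ∀ N : ℕ, c₁ N = cechObjMap (yB D x) (ρ N) 0 (c₁ (N + 1)) := by
    intro N
    have hsum : c₁ N + c₂ N = cechObjMap (yB D x) (ρ N) 0 (c₁ (N + 1)) +
        cechObjMap (yB D x) (ρ N) 0 (c₂ (N + 1)) := by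
      rw [← map_add, ← hc₁₂ (N + 1), hρaug, hc₁₂ N]
    have hpow₁ : 𝔞₁ ^ (e * (N + 1)) ≤ 𝔞₁ ^ (e * N) :=
      Ideal.pow_le_pow_right (Nat.mul_le_mul_left e (Nat.le_succ N))
    have hpow₂ : 𝔞₂ ^ (e * (N + 1)) ≤ 𝔞₂ ^ (e * N) :=
      Ideal.pow_le_pow_right (Nat.mul_le_mul_left e (Nat.le_succ N))
    refine cocycle_split_unique (hsepN (e * (N + 1))) hsum
      (fun a' ha' => hc₁ N a' (hpow₁ ha')) (fun b' hb' => hc₂ N b' (hpow₂ hb'))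
      (fun a' ha' => ?_) (fun b' hb' => ?_)
    · rw [← LinearMap.map_smul, hc₁ (N + 1) a' ha', map_zero]
    · rw [← LinearMap.map_smul, hc₂ (N + 1) b' hb', map_zero]
  have hcompat : ∀ N : ℕ, aseq (N + 1) - aseq N ∈ (g ^ N • ⊤ : Submodule D M) := by
    intro N
    have h1 : cechAug (yB D x) (QuotSMulTop (g ^ N) M) (toQuot (g ^ N) (aseq (N + 1))) =
        cechAug (yB D x) (QuotSMulTop (g ^ N) M) (toQuot (g ^ N) (aseq N)) := by
      rw [← hρaug, haseq (N + 1), LinearMap.map_smul, ← hc₁ρ, haseq N]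
    have h2 : cechAug (yB D x) (QuotSMulTop (g ^ N) M) (toQuot (g ^ N) (aseq (N + 1) - aseq N)) = 0 := by
      rw [map_sub, map_sub, h1, sub_self]
    have h3 := toQuot_eq_zero_of_cechAug_eq_zero (hgreg.pow N) hM0 hM1 _ h2
    exact (Submodule.Quotient.mk_eq_zero _).mp h3
  /- 8. The `g`-adic limit `alim` of the `a_N`. -/
  obtain ⟨alim, halim⟩ := exists_sub_mem_pow_smul_of_compatible (M := M) hgm aseq hcompat
  have hlimaug : ∀ N : ℕ,
      cechAug (yB D x) (QuotSMulTop (g ^ N) M) (toQuot (g ^ N) alim) = g ^ N₀ • c₁ N := by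
    intro N
    rw [← haseq N]
    congr 1
    exact (Submodule.Quotient.eq _).mpr (halim N)
  /- 9. Localising at `Q₂`: `alim = 0`. -/
  have halim0 : alim = 0 := by
    refine eq_zero_of_forall_exists_smul_mem htf (h₂ hg₂) alim fun N => ?_
    obtain ⟨i₂, hi₂⟩ := h₂y
    have hnot : ¬ 𝔞₁ ^ (e * N) ≤ Q₂ := fun hle' => h₂' (Ideal.IsPrime.le_of_pow_le hle')
    obtain ⟨w, hw, hwQ⟩ := SetLike.not_le_iff_exists.mp hnot
    let t₂ : Fin 1 → Fin 3 := fun _ => i₂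
    have hw0 : w • c₁ N t₂ = 0 := by simpa using congrFun (hc₁ N w hw) t₂
    have hcomp : w • (LocalizedModule.mk (toQuot (g ^ N) alim) 1 :
        CechLoc (yB D x) (QuotSMulTop (g ^ N) M) t₂) = 0 := by
      have := congrFun (hlimaug N) t₂
      rw [cechAug_apply] at this
      rw [this]
      change w • (g ^ N₀ • c₁ N t₂) = 0
      rw [smul_comm, hw0, smul_zero]
    obtain ⟨k, hk⟩ := exists_pow_mul_smul_eq_zero_of_smul_mk_eq_zero t₂ w _ hcomp
    rw [tupleProd_const_one] at hk
    refine ⟨yB D x i₂ ^ k * w, ?_, ?_⟩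
    · intro hmem
      rcases (Ideal.IsPrime.mem_or_mem inferInstance hmem) with h | h
      · exact hi₂ (Ideal.IsPrime.mem_of_pow_mem inferInstance k h)
      · exact hwQ h
    · rw [← LinearMap.map_smul] at hk
      exact (Submodule.Quotient.mk_eq_zero _).mp hk
  /- 10. Localising at `Q₁`: `g^{N₀} m = 0`, so `m = 0`. -/
  have hgm0 : g ^ N₀ • m = 0 := by
    refine eq_zero_of_forall_exists_smul_mem htf (h₁ hg₁) (g ^ N₀ • m) fun N => ?_
    obtain ⟨i₁, hi₁⟩ := h₁y
    have hnot : ¬ 𝔞₂ ^ (e * N) ≤ Q₁ := fun hle' => h₁' (Ideal.IsPrime.le_of_pow_le hle')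
    obtain ⟨w, hw, hwQ⟩ := SetLike.not_le_iff_exists.mp hnot
    let t₁ : Fin 1 → Fin 3 := fun _ => i₁
    have hc₁0 : g ^ N₀ • c₁ N = 0 := by
      rw [← hlimaug N, halim0, map_zero, map_zero]
    have hw0 : w • c₂ N t₁ = 0 := by simpa using congrFun (hc₂ N w hw) t₁
    have hcomp : w • (LocalizedModule.mk (toQuot (g ^ N) (g ^ N₀ • m)) 1 :
        CechLoc (yB D x) (QuotSMulTop (g ^ N) M) t₁) = 0 := by
      have h' : cechAug (yB D x) (QuotSMulTop (g ^ N) M) (toQuot (g ^ N) (g ^ N₀ • m)) =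
          g ^ N₀ • c₂ N := by
        rw [LinearMap.map_smul, LinearMap.map_smul, hc₁₂ N, smul_add, hc₁0, zero_add]
      have := congrFun h' t₁
      rw [cechAug_apply] at this
      rw [this]
      change w • (g ^ N₀ • c₂ N t₁) = 0
      rw [smul_comm, hw0, smul_zero]
    obtain ⟨k, hk⟩ := exists_pow_mul_smul_eq_zero_of_smul_mk_eq_zero t₁ w _ hcomp
    rw [tupleProd_const_one] at hk
    refine ⟨yB D x i₁ ^ k * w, ?_, ?_⟩
    · intro hmem
      rcases (Ideal.IsPrime.mem_or_mem inferInstance hmem) with h | h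
      · exact hi₁ (Ideal.IsPrime.mem_of_pow_mem inferInstance k h)
      · exact hwQ h
    · rw [← LinearMap.map_smul] at hk
      exact (Submodule.Quotient.mk_eq_zero _).mp hk
  rcases htf _ _ hgm0 with h | h
  · exact hg0 (pow_eq_zero_iff' |>.mp h).1
  · exact hm0 h

end Core

end Literature.RingTheory.LocalCohomology

end
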